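import Literature.Claims.NS.RomanMiller2011
import Mathlib.Analysis.SpecialFunctions.SmoothTransition
import HarnessLib

/-!
# Solo refutation kernel — C51 `RomanMiller2011` (D-0090 NS-CLAIMS; refuter-4, conv. (b) filing)

L. A. Roman-Miller, arXiv:1103.1408 v1, §5 pp. 9–11: «The Exact General Solution of the Navier Stokes
Equations» — every solution of (14)–(15) is presented as `u = Σ A_{ijkl} xⁱyʲzᵏtˡ`, …, `P = Σ D_{ijkl} xⁱyʲzᵏtˡ`
(p. 10–11) with «the coefficients of the analytic solution … defined by» (18)–(21) (p. 11 l. 19).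
Typed face: `Literature.Claims.NS.RomanMiller2011.Step_general` (every classical solution on all of
space-time is, componentwise, an everywhere-convergent 4-variable power series).

**Kill [refuted-substantive].** For EVERY smooth `g : ℝ → ℝ` the accelerating uniform stream
`u(t,x) = g(t) e₀`, `p(t,x) = −g′(t) x₀` is a classical solution of (14)–(15) on all of space-time (no force,
any `ν`): `∂ₜu = g′e₀ = −∇p`, `(u·∇)u = 0`, `Δu = 0`, `div u = 0`. If `u₀ = Σ A_{ijkl} xⁱyʲzᵏtˡ` converged to
`u₀` everywhere, then on the line `x = 0` the one-variable series `Σ_l A_{000l} tˡ` would converge to `g(t)`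
for every real `t`, so `g` would be the sum of a power series of infinite radius, i.e. real-analytic on `ℝ`
(`hasFPowerSeriesOnBall_of_hasSum`). With `g(t) = expNegInvGlue t` (smooth, `= 0` for `t ≤ 0`, `> 0` for
`t > 0`) the identity theorem forces `g ≡ 0` — contradiction at `t = 1`. Hence `¬ Step_general`, and through
the skeleton's own projection `step_general_of_claim`, `¬ ClaimedTheorem`. The witness is a genuine smooth
(indeed classical, globally defined) Navier–Stokes flow, not a degenerate instance: the printed sentence quantifies
over all solutions of (14)–(15) with no data, domain or analyticity hypothesis. No cheap repair: «every
ANALYTIC solution is such a series» is still false (radius: `g(t) = 1/(1+t²)`), and «every ENTIRE solution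
is such a series» is a tautology that solves nothing.

WHAT THIS IS NOT: not a claim about NS regularity or blow-up; not a claim about any author beyond the typed
locator.
-/

set_option linter.dupNamespace false

noncomputable section

open Set Function Filter Topology InnerProductSpace
open scoped ContDiff Topology ENNReal NNReal Laplacian
open Literature.Analysis.FluidPDE Literature.Claims.NS.RomanMiller2011

namespace Summit.NavierStokesRegularity.NavierStokesRegularity.Theorems.RomanMiller2011

/-! ### §1 The accelerating uniform stream `u = g(t) e₀`, `p = −g′(t) x₀` -/

/-- The unit vector `e₀ = (1, 0, 0)`. [folklore] -/
def e0 : E3 := EuclideanSpace.single 0 1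

/-- The accelerating uniform stream `u(t, x) = g(t) e₀`. [folklore] -/
def stream (g : ℝ → ℝ) : ℝ → E3 → E3 := fun t _ => g t • e0

/-- Its pressure `p(t, x) = −g′(t) x₀` (a uniform pressure gradient driving the acceleration). [folklore] -/
def streamPressure (g : ℝ → ℝ) : ℝ → E3 → ℝ := fun t x => -deriv g t * x 0

/-- The pressure slice has derivative `−g′(t) · proj₀`. [folklore] -/
theorem hasFDerivAt_streamPressure (g : ℝ → ℝ) (t : ℝ) (x : E3) :
    HasFDerivAt (streamPressure g t) ((-deriv g t) • (EuclideanSpace.proj 0 : E3 →L[ℝ] ℝ)) x :=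
  ((EuclideanSpace.proj (0 : Fin 3) : E3 →L[ℝ] ℝ).hasFDerivAt).const_mul (-deriv g t)

/-- `∇p(t, ·) = −g′(t) e₀`. [folklore] -/
theorem gradient_streamPressure (g : ℝ → ℝ) (t : ℝ) (x : E3) :
    gradient (streamPressure g t) x = (-deriv g t) • e0 := by
  have hL : (-deriv g t) • (EuclideanSpace.proj 0 : E3 →L[ℝ] ℝ) = toDual ℝ E3 ((-deriv g t) • e0) := by
    ext v
    simp [e0, EuclideanSpace.inner_single_left]
  have hG : HasGradientAt (streamPressure g t) ((-deriv g t) • e0) x := by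
    rw [hasGradientAt_iff_hasFDerivAt, ← hL]
    exact hasFDerivAt_streamPressure g t x
  exact hG.gradient

/-- The stream's slices are constant in space: `D(u(t, ·)) = 0`. [folklore] -/
theorem fderiv_stream (g : ℝ → ℝ) (t : ℝ) (x : E3) : fderiv ℝ (stream g t) x = 0 := by
  rw [show stream g t = fun _ : E3 => g t • e0 from rfl]
  simp

/-- **The stream is a classical Navier–Stokes solution on all of space-time** for every smooth `g` and every
`ν`: `∂ₜu + (u·∇)u = g′e₀ = νΔu − ∇p`, `div u = 0`. [folklore] -/
theorem isClassicalNSSolutionOn_stream {g : ℝ → ℝ} (hg : ContDiff ℝ ∞ g) (ν : ℝ) :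
    IsClassicalNSSolutionOn univ ν 0 (stream g) (streamPressure g) where
  smooth_velocity := by
    have h : ContDiff ℝ ∞ (uncurry (stream g)) :=
      (hg.comp contDiff_fst).smul contDiff_const
    exact h.contDiffOn
  smooth_pressure := by
    have hg' : ContDiff ℝ ∞ (deriv g) := by simpa using hg.iterate_deriv 1
    have h0 : ContDiff ℝ ∞ (fun x : E3 => x 0) := contDiff_piLp_apply (p := 2)
    have h : ContDiff ℝ ∞ (uncurry (streamPressure g)) :=
      ((hg'.comp contDiff_fst).neg).mul (h0.comp contDiff_snd)
    exact h.contDiffOn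
  momentum := by
    intro t _ x
    have hdt : timeDerivWithin univ (stream g) t x = deriv g t • e0 := by
      rw [timeDerivWithin_apply, derivWithin_univ]
      exact ((hg.differentiable (by simp)).differentiableAt.hasDerivAt.smul_const e0).deriv
    have hconv : convect (stream g t) (stream g t) x = 0 := by
      simp [convect, fderiv_stream]
    have hlap : Δ (stream g t) x = 0 := by
      have : stream g t = fun _ : E3 => g t • e0 := rfl
      rw [this, laplacian_const]
      rfl
    rw [hdt, hconv, hlap, gradient_streamPressure]
    simp
  divFree := by
    intro t _ x
    simp [VectorCalculus.divergence, fderiv_stream]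

/-- The first component of the stream is `g`. [folklore] -/
@[simp] theorem stream_apply_zero (g : ℝ → ℝ) (t : ℝ) (x : E3) : stream g t x 0 = g t := by
  simp [stream, e0]

/-! ### §2 A power series converging on all of `ℝ` sums to a real-analytic function -/

/-- If `Σ_l a_l t^l` converges to `f(t)` for EVERY real `t`, then `f` is the sum of the formal power series
`ofScalars ℝ a` on the ball of radius `∞` about `0`. [folklore] -/
theorem hasFPowerSeriesOnBall_of_hasSum {a : ℕ → ℝ} {f : ℝ → ℝ}
    (h : ∀ t : ℝ, HasSum (fun l => a l * t ^ l) (f t)) :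
    HasFPowerSeriesOnBall f (FormalMultilinearSeries.ofScalars ℝ a) 0 ⊤ := by
  set p : FormalMultilinearSeries ℝ ℝ ℝ := FormalMultilinearSeries.ofScalars ℝ a with hp
  have hrad : p.radius = ⊤ := by
    refine ENNReal.eq_top_of_forall_nnreal_le fun r => ?_
    refine p.le_radius_of_tendsto (l := 0) ?_
    have ht : Tendsto (fun n => a n * (r : ℝ) ^ n) atTop (𝓝 0) := (h r).summable.tendsto_atTop_zero
    have ht' := ht.norm
    rw [norm_zero] at ht'
    refine ht'.congr fun n => ?_
    rw [hp, FormalMultilinearSeries.ofScalars_norm, norm_mul, norm_pow, Real.norm_of_nonneg r.coe_nonneg]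
  have hball : HasFPowerSeriesOnBall p.sum p 0 ⊤ := by
    rw [← hrad]
    exact p.hasFPowerSeriesOnBall (by simp [hrad])
  have hsum : ∀ t, p.sum t = f t := by
    intro t
    have h1 : HasSum (fun n => p n fun _ => t) (p.sum t) := by
      have := hball.hasSum (y := t) (by simp)
      simpa using this
    have h2 : (fun n => p n fun _ => t) = fun n => a n * t ^ n := by
      funext n
      rw [hp, FormalMultilinearSeries.ofScalars_apply_eq, smul_eq_mul, mul_comm]
    rw [h2] at h1
    exact h1.unique (h t)
  have hpf : p.sum = f := funext hsum
  rw [← hpf]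
  exact hball

/-- Hence such an `f` is real-analytic on all of `ℝ` …. [folklore] -/
theorem analyticOnNhd_of_hasSum {a : ℕ → ℝ} {f : ℝ → ℝ}
    (h : ∀ t : ℝ, HasSum (fun l => a l * t ^ l) (f t)) : AnalyticOnNhd ℝ f univ :=
  fun y _ => (hasFPowerSeriesOnBall_of_hasSum h).analyticAt_of_mem (by simp)

/-- … and if it vanishes for `t ≤ 0` it vanishes identically (identity theorem on the connected line).
[folklore] -/
theorem eq_zero_of_hasSum_of_vanishes_left {a : ℕ → ℝ} {f : ℝ → ℝ}
    (h : ∀ t : ℝ, HasSum (fun l => a l * t ^ l) (f t)) (hf : ∀ t ≤ 0, f t = 0) (t : ℝ) : f t = 0 := by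
  have hev : f =ᶠ[𝓝 (-1 : ℝ)] 0 := by
    filter_upwards [Iio_mem_nhds (show (-1 : ℝ) < 0 by norm_num)] with s hs
    exact hf s (le_of_lt hs)
  exact (analyticOnNhd_of_hasSum h).eqOn_zero_of_preconnected_of_eventuallyEq_zero isPreconnected_univ
    (mem_univ _) hev (mem_univ t)

/-! ### §3 The line `x = 0` of a 4-variable power series, and the kill -/

/-- On the line `x = 0` the 4-variable series collapses to the one-variable series `Σ_l A_{000l} tˡ`.
[folklore] -/
theorem hasSum_line_of_isSeriesOf {A : Coeff} {f : ℝ → E3 → ℝ} (h : IsSeriesOf A f) (t : ℝ) :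
    HasSum (fun l : ℕ => A 0 0 0 l * t ^ l) (f t 0) := by
  have h0 := h t 0
  let e : ℕ → ℕ × ℕ × ℕ × ℕ := fun l => (0, 0, 0, l)
  have he : Injective e := fun l m hlm => by simpa [e] using hlm
  have hsupp : ∀ n ∉ Set.range e,
      (fun n : ℕ × ℕ × ℕ × ℕ => A n.1 n.2.1 n.2.2.1 n.2.2.2 * monomial 0 t n) n = 0 := by
    rintro ⟨i, j, k, l⟩ hn
    have hijk : ¬ (i = 0 ∧ j = 0 ∧ k = 0) := by
      rintro ⟨rfl, rfl, rfl⟩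
      exact hn ⟨l, rfl⟩
    simp only [monomial, PiLp.zero_apply]
    rcases Nat.eq_zero_or_pos i with hi | hi
    · rcases Nat.eq_zero_or_pos j with hj | hj
      · rcases Nat.eq_zero_or_pos k with hk | hk
        · exact absurd ⟨hi, hj, hk⟩ hijk
        · simp [zero_pow hk.ne']
      · simp [zero_pow hj.ne']
    · simp [zero_pow hi.ne']
  have := (he.hasSum_iff hsupp).2 h0
  simpa [Function.comp_def, e, monomial] using this

/-- **Refutes `RomanMiller2011.Step_general` — §5 p. 10–11 «u = Σ A_{ijkl} xⁱyʲzᵏtˡ … the coefficients of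
the analytic solution of the Navier Stokes equations (14)», read as the exact GENERAL solution
[refuted-substantive]**: the smooth accelerating stream `u = expNegInvGlue(t) e₀`, `p = −expNegInvGlue′(t) x₀`
solves (14)–(15) classically on all of space-time (`ν = 1`), but its first component restricted to `x = 0`,
`t ↦ expNegInvGlue t`, is not the sum of any everywhere-convergent power series (it vanishes for `t ≤ 0`
and is positive at `t = 1`; identity theorem). No cheap repair: the analytic sub-reading fails by the radius
of convergence, the entire sub-reading is a tautology; (18)–(21) constrain but never produce a solution.
[cite: RomanMiller2011, §5 pp. 10–11] -/
theorem not_Step_general : ¬ Step_general := by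
  intro h
  obtain ⟨A, B, C, D, hsol⟩ :=
    h 1 one_pos (stream expNegInvGlue) (streamPressure expNegInvGlue)
      (isClassicalNSSolutionOn_stream expNegInvGlue.contDiff 1)
  have hA : IsSeriesOf A (fun t x => stream expNegInvGlue t x 0) := hsol.2.1
  have hline : ∀ t : ℝ, HasSum (fun l : ℕ => A 0 0 0 l * t ^ l) (expNegInvGlue t) := by
    intro t
    simpa using hasSum_line_of_isSeriesOf hA t
  have hzero := eq_zero_of_hasSum_of_vanishes_left hline (fun t ht => expNegInvGlue.zero_of_nonpos ht) 1
  exact (expNegInvGlue.pos_of_pos one_pos).ne' hzero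

/-- **Hence the claimed sentence («the exact general solution of the Navier Stokes equations», abstract p. 1,
§5 pp. 9–11) is false as typed** — through the skeleton's own projection `step_general_of_claim`.
[cite: RomanMiller2011, abstract p. 1; §5 pp. 9–11] -/
theorem not_ClaimedTheorem_and_not_Step_general : ¬ ClaimedTheorem ∧ ¬ Step_general :=
  ⟨fun h => not_Step_general (step_general_of_claim h), not_Step_general⟩

/-! ### §4 The charitable «analytic» sub-reading dies too: `g(t) = 1/(1+t²)` (radius of convergence) -/

/-- The Lorentzian `g(t) = 1/(1+t²)`. [folklore] -/
def lorentz (t : ℝ) : ℝ := 1 / (1 + t ^ 2)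

/-- The Lorentzian is smooth. [folklore] -/
theorem contDiff_lorentz : ContDiff ℝ ∞ lorentz :=
  contDiff_const.div (contDiff_const.add (contDiff_id.pow 2)) fun t => by positivity

/-- The Lorentzian is real-analytic on all of `ℝ`. [folklore] -/
theorem analyticOnNhd_lorentz : AnalyticOnNhd ℝ lorentz univ :=
  analyticOnNhd_const.div (analyticOnNhd_const.add (analyticOnNhd_id.pow 2)) fun t _ => by
    have : (0 : ℝ) < 1 + t ^ 2 := by positivity
    exact this.ne'

/-- Its Taylor coefficients at `0`: `1, 0, −1, 0, 1, 0, …`. [folklore] -/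
def lorentzCoeff (n : ℕ) : ℝ := if Even n then (-1) ^ (n / 2) else 0

/-- `Σ lorentzCoeff n tⁿ = 1/(1+t²)` for `|t| < 1` (geometric series in `−t²`). [folklore] -/
theorem hasSum_lorentzCoeff {t : ℝ} (ht : |t| < 1) :
    HasSum (fun n : ℕ => lorentzCoeff n * t ^ n) (lorentz t) := by
  have hr : |(-(t ^ 2))| < 1 := by
    rw [abs_neg, abs_pow]
    exact pow_lt_one₀ (abs_nonneg t) ht (by norm_num)
  have hgeo : HasSum (fun k : ℕ => (-(t ^ 2)) ^ k) (lorentz t) := by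
    convert hasSum_geometric_of_abs_lt_one hr using 1
    simp [lorentz]
  let e : ℕ → ℕ := fun k => 2 * k
  have he : Injective e := fun k m h => by simpa [e] using h
  have hsupp : ∀ n ∉ Set.range e, lorentzCoeff n * t ^ n = 0 := by
    intro n hn
    have hodd : ¬ Even n := fun ⟨k, hk⟩ => hn ⟨k, by simp [e, hk, two_mul]⟩
    simp [lorentzCoeff, hodd]
  refine (he.hasSum_iff hsupp).1 ?_
  convert hgeo using 1
  funext k
  simp only [Function.comp_apply, e, lorentzCoeff, even_two_mul, if_true]
  rw [Nat.mul_div_cancel_left k two_pos, pow_mul, neg_pow (t ^ 2)]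

/-- `1/(1+t²)` has the power series `ofScalars ℝ lorentzCoeff` at `0`, on the unit ball. [folklore] -/
theorem hasFPowerSeriesOnBall_lorentz :
    HasFPowerSeriesOnBall lorentz (FormalMultilinearSeries.ofScalars ℝ lorentzCoeff) 0 1 := by
  set q : FormalMultilinearSeries ℝ ℝ ℝ := FormalMultilinearSeries.ofScalars ℝ lorentzCoeff with hq
  have hrad : (1 : ℝ≥0∞) ≤ q.radius := by
    refine ENNReal.le_of_forall_nnreal_lt fun r hr => ?_
    have hr' : (r : ℝ) < 1 := by exact_mod_cast hr
    refine q.le_radius_of_tendsto (l := 0) ?_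
    have habs : |(r : ℝ)| < 1 := by rwa [abs_of_nonneg r.coe_nonneg]
    have ht := ((hasSum_lorentzCoeff habs).summable.tendsto_atTop_zero).norm
    rw [norm_zero] at ht
    refine ht.congr fun n => ?_
    rw [hq, FormalMultilinearSeries.ofScalars_norm, norm_mul, norm_pow, Real.norm_of_nonneg r.coe_nonneg]
  refine ⟨hrad, by norm_num, fun {y} hy => ?_⟩
  have hy' : |y| < 1 := by
    have h1 : ‖y‖ₑ < 1 := mem_eball_zero_iff.1 hy
    rw [← ofReal_norm, ENNReal.ofReal_lt_one, Real.norm_eq_abs] at h1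
    exact h1
  have h2 : (fun n => q n fun _ => y) = fun n => lorentzCoeff n * y ^ n := by
    funext n
    rw [hq, FormalMultilinearSeries.ofScalars_apply_eq, smul_eq_mul]
  rw [h2, zero_add]
  exact hasSum_lorentzCoeff hy'

/-- **No everywhere-convergent power series sums to `1/(1+t²)` on `ℝ`** (its Taylor series at `0` is forced,
and diverges at `t = 2`). [folklore] -/
theorem not_hasSum_lorentz (a : ℕ → ℝ) : ¬ ∀ t : ℝ, HasSum (fun l => a l * t ^ l) (lorentz t) := by
  intro h
  have hpa := (hasFPowerSeriesOnBall_of_hasSum h).hasFPowerSeriesAt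
  have hpq := hasFPowerSeriesOnBall_lorentz.hasFPowerSeriesAt
  have heq : a = lorentzCoeff :=
    (FormalMultilinearSeries.ofScalars_series_eq_iff (E := ℝ) a lorentzCoeff).1
      (hpa.eq_formalMultilinearSeries hpq)
  have ht := (h 2).summable.tendsto_atTop_zero
  rw [heq, Metric.tendsto_atTop] at ht
  obtain ⟨N, hN⟩ := ht 1 one_pos
  have hlt := hN (2 * N) (by omega)
  rw [Real.dist_0_eq_abs] at hlt
  have hge : (1 : ℝ) ≤ |lorentzCoeff (2 * N) * (2 : ℝ) ^ (2 * N)| := by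
    simp only [lorentzCoeff, even_two_mul, if_true]
    rw [Nat.mul_div_cancel_left N two_pos, abs_mul, abs_pow, abs_neg, abs_one, one_pow, one_mul, abs_pow,
      abs_two]
    exact one_le_pow₀ (by norm_num)
  linarith

/-- **The «analytic solution» sub-reading (p. 11 l. 19) is no repair**: the stream with `g(t) = 1/(1+t²)` is a
classical, real-analytic-in-time (entire in space) Navier–Stokes solution on all of space-time whose first
component on the line `x = 0` is the sum of NO everywhere-convergent power series — so «every analytic
solution of (14) is `Σ A_{ijkl} xⁱyʲzᵏtˡ`» is false as well. [cite: RomanMiller2011, §5 p. 11] -/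
theorem lorentzStream_not_series (ν : ℝ) :
    IsClassicalNSSolutionOn univ ν 0 (stream lorentz) (streamPressure lorentz) ∧
      AnalyticOnNhd ℝ lorentz univ ∧ ¬ ∃ A : Coeff, IsSeriesOf A (fun t x => stream lorentz t x 0) := by
  refine ⟨isClassicalNSSolutionOn_stream contDiff_lorentz ν, analyticOnNhd_lorentz, ?_⟩
  rintro ⟨A, hA⟩
  refine not_hasSum_lorentz (fun l => A 0 0 0 l) fun t => ?_
  simpa using hasSum_line_of_isSeriesOf hA t

end Summit.NavierStokesRegularity.NavierStokesRegularity.Theorems.RomanMiller2011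

end
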